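import Summits.BirchSwinnertonDyer.Rank1Residual.X11b.LevelLiftingLower
import Literature.NumberTheory.EllipticCurves.WeilPairingProofs
import Literature.NumberTheory.EllipticCurves.PointDivisibilityProofs
import HarnessLib

/-!
# X11b, route R1 — (P9) DISCHARGED MODULO FINITENESS: `LevelLiftingAt` (hence JSW17 Prop. 3.3.2,
# `LocSurjAt`) from Poitou–Tate duality and the finiteness of Castella's relaxed conjugate group

HONEST FRAMING (cell `b2b-bsdres`, run/shared/lean/b2b/bsd-rank1-residual/, verbatim in every
file): the goal of the cell is to DELETE the COMBINATION-SHAPED residual classes of the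
Birch–Swinnerton-Dyer formula for ALL analytic-rank `≤ 1` elliptic curves over `ℚ` — "full BSD
formula for every rank `≤ 1` curve in class `C`" assembled STRICTLY from published theorems — so
that the rank-`≤ 1` remainder becomes exactly the CONSTRUCTION-SHAPED classes, which are TYPED
(missing-input `Prop`s), NOT attempted. This is not "finishing BSD". Sub-cell
`b2b-bsdres-multr1-p1` (X11b, route R1 = Castella 2018 Thm. A re-proved along the author's
erratum); a RESEARCH ROUTE; no claim beyond the stated class; X11b stays CONSTRUCTION-SHAPED;
nothing here changes a label; no named fact is minted (theorems only; no `sorry`).  The theorems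
are CONDITIONAL on the tree's cited named fact `poitouTate_selmerStructure_duality` (Howard 2004
Thm. 2.1.11 / Milne I 4.10(b), taken as a hypothesis `hPT`).

## What is here — JSW17's proof of Prop. 3.3.2, in the kernel

Jetchev–Skinner–Wan, *Camb. J. Math.* 5 (2017), Prop. 3.3.2 (arXiv:1512.06894 p. 11): "By
Theorem 2.3.4 [Poitou–Tate] the dual of the cokernel of (restrict-eq1) is identified with a quotient
of `H¹_{(𝓕_ac^S)_v̄}(K, M[p^N]^*)` … it suffices to show `H¹_{(𝓕_ac^S)_v̄}(K, T) = 0` … since it is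
torsion-free and injects into the finite `H¹_{(𝓕_ac^S)_v̄}(K, W)`."  In the tree's finite-level
vocabulary (the atom (P9) was reduced to `LevelLiftingAt` in `LocSurjFromLevels`):

* `sum_localTatePairingZMod_liftFamily_eq_zero` — **the Poitou–Tate obstruction vanishes**: for the
  test family `t` (`liftFamily`: `t_w = H¹(ι|_w) s_w` on `Σ`, `0` elsewhere) at level `N = K₀ + e` and
  every `y ∈ H¹_{𝓕^*}(K, E[p^N]^D)` (`𝓕 = lowerStructure`), `∑_{v∈T} ⟨t_v, y_v⟩_v = 0`.  Proof: Weil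
  transport `ỹ = H¹(w⁻¹) y`; `H¹(ι_N) ỹ` lies in Castella's relaxed conjugate group
  (`map_weilTransport_mem_selmerGroup_acStructure`), which `p^e` kills; so
  `H¹(ι_{K₀})(H¹(π) ỹ) = p^e H¹(ι_N) ỹ = 0`, and `H¹(ι_{K₀})` is injective (`E(K)[p] = 0`): `H¹(π) ỹ = 0`;
  hence each local term `⟨H¹(ι) s_w, y_w⟩_w = inv_w(H¹(ι) s_w ∪_e ỹ_w) = inv_w(s_w ∪_{desc} H¹(π) ỹ_w) = 0`
  (`LevelShiftMaps`, `WeilTransport`).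
* **`levelLiftingAt_of_finite`**: `LevelLiftingAt W p 𝔭 Σ` for every finite-type `Σ` away from `p`,
  GIVEN (i) the Poitou–Tate fact, (ii) `K` totally complex, (iii) `E(K̄)[p^∞]^{Γ_K} = 0`
  (`E(K)[p] = 0`), (iv) `𝔭, 𝔮 ∣ p`, `𝔮 ≠ 𝔭`, (v) a finite set of places `T ⊇ ∞ ∪ {v∣p} ∪ Σ ∪ {bad}`,
  and (vi) the FINITENESS of Castella's conjugate Selmer group relaxed on `R = {v ∈ T : v ∤ p}`,
  `H¹_{𝓛^{ac,R}_𝔮}(K, E[p^∞])` (strict at `𝔮 = 𝔭̄`, relaxed at `𝔭` and on `R`, trivial elsewhere).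
  Apply `SelmerComplement` (i) to `𝓕 ≤ 𝓛^{(N),Σ}`; `𝓕 = 0` on `Σ` makes the lift EXACT there.
* **`locSurjAt_of_finite`**: hence atom (P9) `LocSurjAt W p 𝔭 Σ` under the same hypotheses.

What (vi) costs (successor): `Finite (Sel_𝔮(K, E[p^∞]))` for `Σ = ∅` (multr1-p2's `≤`-half,
`BDPRouteLevelToKummer`: uniform bound ⟹ finite) plus the finiteness of `H¹(K_v, E[p^∞])` at the
finitely many `v ∈ R` (`v ∤ p`; `#H¹(K_v, E[p^k]) = #E(K_v)[p^k]²`, tree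
`LocalEulerCharacteristicTorsion`, and Lutz–Mattuck finiteness of `E(K_v)[p^∞]`, tree
`finite_setOf_forall_map_eq_and_nsmul_eq_zero`).  Hypothesis (iv) of the erratum (`E(ℚ_p)[p] = 0`) is
NOT used here.

References: [JetchevSkinnerWan2017] Prop. 3.3.2; [Howard2004HeegnerKolyvagin] Thm. 2.1.11;
[MilneADT2006] I Cor. 2.3, Thm. 2.6, Thm. 4.10(b), §6; [Castella2018] Def. 2.2, Thm. 2.3;
[GreenbergLNM1716] §5 proof of Prop. 5.8.
-/

noncomputable section

open scoped Classical

open CategoryTheory Field NumberField IsDedekindDomain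
open Literature.NumberTheory.EllipticCurves Literature.NumberTheory.EllipticCurves.GreenbergSelmer
open Literature.NumberTheory.GaloisRepresentations
open Literature.NumberTheory.GaloisRepresentations.DiscreteGaloisModule (SelmerStructure TateDual tateDual
  localTatePairingZMod unramifiedSubgroup)
open Literature.NumberTheory.GaloisCohomology
open scoped ContRepresentation

namespace Summit.BirchSwinnertonDyer.Rank1Residual.X11b.AcSelmer

open Summit.BirchSwinnertonDyer.Rank1Residual.X11b.LocBridge
open Summit.BirchSwinnertonDyer.Rank1Residual.X11b.Levels

-- Cup products need `LocallyCompactSpace Γ`; finiteness of `E[p^k]`, `NeZero (p^k)`: local instances.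
attribute [local instance] absoluteGaloisGroup_compactSpace Levels.neZero_pow finite_geomTorsion_pow

variable {K : Type} [Field K] [NumberField K] (W : WeierstrassCurve K) [W.IsElliptic] (p : ℕ)
  [Fact p.Prime] (𝔭 : HeightOneSpectrum (𝓞 K)) {S : Set (HeightOneSpectrum (𝓞 K))}
  (T : Finset (Place K)) (K₀ e : ℕ)

/-! ## §1. The Poitou–Tate obstruction vanishes -/

/-- **The Poitou–Tate obstruction of (P9) vanishes** (JSW17, proof of Prop. 3.3.2, at the finite
level `N = K₀ + e`): with `t = liftFamily W p K₀ e s` and `𝓕 = lowerStructure W p N 𝔭 Σ T`, for every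
`y ∈ H¹_{𝓕^*}(K, E[p^N]^D)`, `∑_{v ∈ T} ⟨t_v, loc_v y⟩_v = 0`, provided `p^e` kills Castella's relaxed
conjugate group `H¹_{𝓛^{ac,R}_𝔮}(K, E[p^∞])` and `E(K̄)[p^∞]^{Γ_K} = 0`.  Chain: `ỹ = H¹(w⁻¹) y`,
`H¹(ι_N) ỹ ∈ H¹_{𝓛^{ac,R}_𝔮}` (`map_weilTransport_mem_selmerGroup_acStructure`), so
`H¹(ι_{K₀})(H¹(π) ỹ) = p^e · H¹(ι_N) ỹ = 0`, so `H¹(π) ỹ = 0` (`map_primaryInclusion_injective`), so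
`⟨H¹(ι) s_w, loc_w y⟩_w = inv_w(H¹(ι) s_w ∪_e loc_w ỹ) = inv_w(s_w ∪_desc H¹(π) loc_w ỹ) = 0`.
[cite: JetchevSkinnerWan2017, Prop. 3.3.2 (arXiv:1512.06894 p. 11)] [cite: MilneADT2006, Ch. I §6, proof of Prop. 6.9] -/
theorem sum_localTatePairingZMod_liftFamily_eq_zero (hK : ∀ w : InfinitePlace K, w.IsComplex)
    (hΓ : ∀ Q : W.geomPrimaryTorsion p,
      (∀ σ : absoluteGaloisGroup K, primaryGaloisModule W p σ Q = Q) → Q = 0)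
    {𝔮 : HeightOneSpectrum (𝓞 K)} (h𝔮 : ((p : ℕ) : 𝓞 K) ∈ 𝔮.asIdeal) (hne : 𝔮 ≠ 𝔭)
    (hSig : ∀ v ∈ S, (Sum.inr v : Place K) ∈ T)
    (hbad : ∀ v : HeightOneSpectrum (𝓞 K), ¬ W.HasGoodReductionAt v → (Sum.inr v : Place K) ∈ T)
    (he1 : 1 ≤ e)
    (he : ∀ x ∈ (acStructure (primaryGaloisModule W p) p 𝔮
      {v | (Sum.inr v : Place K) ∈ T ∧ ((p : ℕ) : 𝓞 K) ∉ v.asIdeal}).selmerGroup, p ^ e • x = 0)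
    {inv : LocalInvariants K (p ^ (K₀ + e))} (hperf : inv.IsPerfect) (hur : inv.UnramifiedOrthogonal)
    (s : ∀ v : S, galoisCohomology (GaloisRep.restrictField
      (Place.Completion (Sum.inr (v : HeightOneSpectrum (𝓞 K)) : Place K))
      (W.torsionGaloisModule ((p ^ K₀ : ℕ) : ℤ))) 1)
    {y : galoisCohomology ((W.torsionGaloisModule ((p ^ (K₀ + e) : ℕ) : ℤ)).tateDual (p ^ (K₀ + e))) 1}
    (hy : y ∈ (inv.dualSelmerStructure (W.torsionGaloisModule ((p ^ (K₀ + e) : ℕ) : ℤ))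
        (lowerStructure W p (K₀ + e) 𝔭 S T)).selmerGroup) :
    ∑ v ∈ T, localTatePairingZMod (W.torsionGaloisModule ((p ^ (K₀ + e) : ℕ) : ℤ)) (p ^ (K₀ + e)) v
        (inv v) (liftFamily W p K₀ e s v)
        (galoisCohomology.localization
          ((W.torsionGaloisModule ((p ^ (K₀ + e) : ℕ) : ℤ)).tateDual (p ^ (K₀ + e))) v 1 y) = 0 := by
  have hprime : p.Prime := Fact.out
  have hdiv : W.zsmul_geomPoints_surjective := W.zsmul_geomPoints_surjective_holds
  -- a Weil pairing on `E[p^N]`, `N = K₀ + e ≥ 1`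
  have hp2 : 2 ≤ p ^ (K₀ + e) := le_trans hprime.two_le (Nat.le_self_pow (by omega) p)
  have hchar : ((p ^ (K₀ + e) : ℕ) : K) ≠ 0 := Nat.cast_ne_zero.mpr (pow_ne_zero _ hprime.ne_zero)
  obtain ⟨ε, hμ, hadd₁, hadd₂, -, hnondeg, hgal⟩ := W.exists_weilPairing_holds (p ^ (K₀ + e)) hp2 hchar
  set yW := galoisCohomology.map (weilDualInv W (p ^ (K₀ + e)) ε hμ hadd₁ hadd₂ hgal hnondeg) 1 y
    with hyWdef
  have hyW : galoisCohomology.map (weilDualIntertwining W (p ^ (K₀ + e)) ε hμ hadd₁ hadd₂ hgal) 1 yW = y :=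
    map_weilDual_map_weilDualInv W (p ^ (K₀ + e)) ε hμ hadd₁ hadd₂ hgal hnondeg y
  -- `H¹(ι_N) ỹ` lies in the relaxed conjugate group, hence is killed by `p^e`
  have hc := map_weilTransport_mem_selmerGroup_acStructure W p 𝔭 T ε hμ hadd₁ hadd₂ hgal hnondeg
    hK h𝔮 hne hSig hbad hperf hur hy
  have hkill : p ^ e • galoisCohomology.map (primaryInclusion W p (K₀ + e)) 1 yW = 0 := he _ hc
  -- level shift: `H¹(π) ỹ = 0`
  have hπ : galoisCohomology.map (levelMul W p K₀ e) 1 yW = 0 := by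
    apply map_primaryInclusion_injective W p K₀ hΓ
    rw [map_primaryInclusion_map_levelMul, hkill, map_zero]
  refine Finset.sum_eq_zero fun v _ ↦ ?_
  rcases v with w | v
  · rw [liftFamily_inl, map_zero, AddMonoidHom.zero_apply]
  · by_cases hvS : v ∈ S
    · have hπv : galoisCohomology.map ((levelMul W p K₀ e).restrictField
          (Place.Completion (Sum.inr v : Place K))) 1
          (galoisCohomology.localization (W.torsionGaloisModule ((p ^ (K₀ + e) : ℕ) : ℤ))
            (Sum.inr v) 1 yW) = 0 := by
        rw [← localization_map_one, hπ]
        exact map_zero _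
      rw [liftFamily_inr_of_mem W p K₀ e s hvS, ← hyW, localization_map_one,
        localTatePairingZMod_map_weilDual, weilContPairingLocal_cupProduct_eq_restrict,
        cupProduct_restrict_weil_map_levelIncl_eq_zero W p K₀ e hdiv ε hμ hadd₁ hadd₂ hgal
          (Place.Completion (Sum.inr v : Place K)) (s ⟨v, hvS⟩) hπv]
      exact map_zero _
    · rw [liftFamily_inr_of_not_mem W p K₀ e s hvS, map_zero, AddMonoidHom.zero_apply]

/-! ## §2. `LevelLiftingAt` from Poitou–Tate duality and finiteness -/

/-- **(P9)'s finite-level form `LevelLiftingAt W p 𝔭 Σ`, PROVED from Poitou–Tate duality and the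
finiteness of Castella's relaxed conjugate Selmer group** (JSW17 Prop. 3.3.2 = the atom (P9) of
Cas18 Thm. 2.3, in the kernel modulo the cited Poitou–Tate fact).  Hypotheses: `hPT` the tree's named
fact `poitouTate_selmerStructure_duality K` (Howard Thm. 2.1.11 / Milne I 4.10(b), CITED); all
infinite places of `K` complex; `E(K̄)[p^∞]^{Γ_K} = 0` (i.e. `E(K)[p] = 0`); `𝔭, 𝔮 ∣ p` with `𝔮 ≠ 𝔭`
(for `p = 𝔭𝔭̄` split in `K`: `𝔮 = 𝔭̄`); `Σ` away from `p`; a finite set of places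
`T ⊇ ∞ ∪ {v ∣ p} ∪ Σ ∪ {bad}`; and `Finite (H¹_{𝓛^{ac,R}_𝔮}(K, E[p^∞]))`, Castella's Selmer structure for
the conjugate prime relaxed on `R = {v ∈ T : v ∤ p}`.  Given `τ_w ∈ H¹(K_w, E[p^∞])[p^{K₀}]`
(`w ∈ Σ`): lift to `s_w ∈ H¹(K_w, E[p^{K₀}])` (`mem_range_map_primaryInclusion_restrictField_iff`), take
`p^e` killing the relaxed conjugate group, `N = K₀ + e`, a Weil pairing on `E[p^N]`
(`exists_weilPairing_holds`), the Poitou–Tate family at level `p^N`, and apply `SelmerComplement` (i)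
to `lowerStructure ≤ acLevelStructure` with the test family `liftFamily`; the obstruction vanishes
(`sum_localTatePairingZMod_liftFamily_eq_zero`); the lift `x ∈ H¹_{𝓛^{(N),Σ}}(K, E[p^N])` has
`loc_w x = H¹(ι) s_w` EXACTLY on `Σ` (`𝓕_w = 0` there), so `loc_w (H¹(ι_N) x) = H¹(ι_{K₀}) s_w = τ_w`.
[cite: JetchevSkinnerWan2017, Prop. 3.3.2 (arXiv:1512.06894 p. 11)]
[cite: Howard2004HeegnerKolyvagin, Thm. 2.1.11 (arXiv:1202.6340 p. 6)]
[cite: Castella2018, Thm. 2.3 (arXiv:1704.06608 p. 5)] -/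
theorem levelLiftingAt_of_finite (hPT : poitouTate_selmerStructure_duality K)
    (hK : ∀ w : InfinitePlace K, w.IsComplex)
    (hΓ : ∀ Q : W.geomPrimaryTorsion p,
      (∀ σ : absoluteGaloisGroup K, primaryGaloisModule W p σ Q = Q) → Q = 0)
    {𝔮 : HeightOneSpectrum (𝓞 K)} (h𝔭 : ((p : ℕ) : 𝓞 K) ∈ 𝔭.asIdeal)
    (h𝔮 : ((p : ℕ) : 𝓞 K) ∈ 𝔮.asIdeal) (hne : 𝔮 ≠ 𝔭)
    (hSp : ∀ v ∈ S, ((p : ℕ) : 𝓞 K) ∉ v.asIdeal)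
    (hinf : ∀ w : InfinitePlace K, (Sum.inl w : Place K) ∈ T)
    (hp : ∀ v : HeightOneSpectrum (𝓞 K), ((p : ℕ) : 𝓞 K) ∈ v.asIdeal → (Sum.inr v : Place K) ∈ T)
    (hSig : ∀ v ∈ S, (Sum.inr v : Place K) ∈ T)
    (hbad : ∀ v : HeightOneSpectrum (𝓞 K), ¬ W.HasGoodReductionAt v → (Sum.inr v : Place K) ∈ T)
    (hfin : Finite ((acStructure (primaryGaloisModule W p) p 𝔮
      {v | (Sum.inr v : Place K) ∈ T ∧ ((p : ℕ) : 𝓞 K) ∉ v.asIdeal}).selmerGroup)) :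
    LevelLiftingAt W p 𝔭 S := by
  intro K₀ τ hτ
  have hdiv : W.zsmul_geomPoints_surjective := W.zsmul_geomPoints_surjective_holds
  -- the exponent `e ≥ 1` of the relaxed conjugate group and the level `N = K₀ + e`
  haveI := hfin
  obtain ⟨e, he1, he⟩ := exists_pow_nsmul_eq_zero_of_finite
    ((acStructure (primaryGaloisModule W p) p 𝔮
      {v | (Sum.inr v : Place K) ∈ T ∧ ((p : ℕ) : 𝓞 K) ∉ v.asIdeal}).selmerGroup)
  -- the Poitou–Tate family at level `p^N`
  obtain ⟨inv, hperf, -, hur, hcompl⟩ := hPT (p ^ (K₀ + e))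
  -- local lifts `s_w ∈ H¹(K_w, E[p^{K₀}])` of the `τ_w`
  have hs : ∀ v : S, ∃ sv : galoisCohomology (GaloisRep.restrictField
      (Place.Completion (Sum.inr (v : HeightOneSpectrum (𝓞 K)) : Place K))
      (W.torsionGaloisModule ((p ^ K₀ : ℕ) : ℤ))) 1,
      galoisCohomology.map ((primaryInclusion W p K₀).restrictField
        (Place.Completion (Sum.inr (v : HeightOneSpectrum (𝓞 K)) : Place K))) 1 sv = τ v := fun v ↦
    (mem_range_map_primaryInclusion_restrictField_iff W p K₀ _ hdiv (τ v)).mpr (hτ v)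
  choose s hs using hs
  -- the Poitou–Tate data
  have hMn : ∀ m : W.geomTorsion ((p ^ (K₀ + e) : ℕ) : ℤ), (p ^ (K₀ + e)) • m = 0 := fun m ↦
    AddSubgroup.torsionBy.nsmul m
  have hTout : ∀ v : HeightOneSpectrum (𝓞 K), (Sum.inr v : Place K) ∉ T →
      ((p ^ (K₀ + e) : ℕ) : 𝓞 K) ∉ v.asIdeal ∧
        GaloisRep.IsUnramifiedAt v (W.torsionGaloisModule ((p ^ (K₀ + e) : ℕ) : ℤ)) := by
    intro v hv
    have hpv : ((p : ℕ) : 𝓞 K) ∉ v.asIdeal := fun h ↦ hv (hp v h)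
    have hgood : W.HasGoodReductionAt v := by
      by_contra hbad'
      exact hv (hbad v hbad')
    exact ⟨natCast_pow_not_mem p hpv _,
      isUnramifiedAt_torsionGaloisModule W hgood (intCast_pow_not_mem p hpv _)⟩
  have ht : ∀ v ∈ T, liftFamily W p K₀ e s v ∈ acLevelStructure W p (K₀ + e) 𝔭 S v := by
    intro v _
    rcases v with w | v
    · rw [liftFamily_inl]; exact zero_mem _
    · by_cases hvS : v ∈ S
      · have hvne : v ≠ 𝔭 := fun h ↦ hSp v hvS (h ▸ h𝔭)
        rw [acLevelStructure_eq_top_of_mem_S W p (K₀ + e) 𝔭 S hvS hvne]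
        exact AddSubgroup.mem_top _
      · rw [liftFamily_inr_of_not_mem W p K₀ e s hvS]; exact zero_mem _
  -- Poitou–Tate: the lift exists
  obtain ⟨x, hx, hxt⟩ := (hcompl (W.torsionGaloisModule ((p ^ (K₀ + e) : ℕ) : ℤ)) hMn T hTout
    (lowerStructure W p (K₀ + e) 𝔭 S T) (acLevelStructure W p (K₀ + e) 𝔭 S)
    (lowerStructure_le W p (K₀ + e) 𝔭 S T)
    (lowerStructure_isUnramifiedOutside W p (K₀ + e) 𝔭 S T hinf hp hSig hbad)
    (acLevelStructure_isUnramifiedOutside W p (K₀ + e) 𝔭 S T hinf hp hSig hbad)).1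
    (liftFamily W p K₀ e s) ht fun y hy ↦
      sum_localTatePairingZMod_liftFamily_eq_zero W p 𝔭 T K₀ e hK hΓ h𝔮 hne hSig hbad he1 he hperf hur
        s hy
  refine ⟨K₀ + e, x, hx, fun v ↦ ?_⟩
  have hv := hxt (Sum.inr (v : HeightOneSpectrum (𝓞 K))) (hSig v v.2)
  rw [lowerStructure_inr_of_mem W p (K₀ + e) 𝔭 S T (hSig v v.2) (hSp v v.2), AddSubgroup.mem_bot,
    sub_eq_zero, liftFamily_inr_of_mem W p K₀ e s v.2] at hv
  rw [localization_map_one, hv, map_primaryInclusion_map_levelIncl_restrictField]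
  exact hs v

/-- **Atom (P9) `LocSurjAt W p 𝔭 Σ` (JSW17 Prop. 3.3.2) under the same hypotheses**, by
`locSurjAt_of_levelLifting`. [cite: JetchevSkinnerWan2017, Prop. 3.3.2 and §3.3.4 (arXiv:1512.06894 pp. 11, 13)]
[cite: Castella2018, Thm. 2.3 (arXiv:1704.06608 p. 5)] -/
theorem locSurjAt_of_finite (hPT : poitouTate_selmerStructure_duality K)
    (hK : ∀ w : InfinitePlace K, w.IsComplex)
    (hΓ : ∀ Q : W.geomPrimaryTorsion p,
      (∀ σ : absoluteGaloisGroup K, primaryGaloisModule W p σ Q = Q) → Q = 0)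
    {𝔮 : HeightOneSpectrum (𝓞 K)} (h𝔭 : ((p : ℕ) : 𝓞 K) ∈ 𝔭.asIdeal)
    (h𝔮 : ((p : ℕ) : 𝓞 K) ∈ 𝔮.asIdeal) (hne : 𝔮 ≠ 𝔭) (hS : S.Finite)
    (hSp : ∀ v ∈ S, ((p : ℕ) : 𝓞 K) ∉ v.asIdeal)
    (hinf : ∀ w : InfinitePlace K, (Sum.inl w : Place K) ∈ T)
    (hp : ∀ v : HeightOneSpectrum (𝓞 K), ((p : ℕ) : 𝓞 K) ∈ v.asIdeal → (Sum.inr v : Place K) ∈ T)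
    (hSig : ∀ v ∈ S, (Sum.inr v : Place K) ∈ T)
    (hbad : ∀ v : HeightOneSpectrum (𝓞 K), ¬ W.HasGoodReductionAt v → (Sum.inr v : Place K) ∈ T)
    (hfin : Finite ((acStructure (primaryGaloisModule W p) p 𝔮
      {v | (Sum.inr v : Place K) ∈ T ∧ ((p : ℕ) : 𝓞 K) ∉ v.asIdeal}).selmerGroup)) :
    LocSurjAt W p 𝔭 hS :=
  locSurjAt_of_levelLifting hS (levelLiftingAt_of_finite W p 𝔭 T hPT hK hΓ h𝔭 h𝔮 hne hSp hinf hp hSig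
    hbad hfin)

end Summit.BirchSwinnertonDyer.Rank1Residual.X11b.AcSelmer

end
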